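import Mathlib
import Summits.ResolutionOfSingularities.ResolutionOfSingularities.Theorems.RadicialJungCleanModelsGenericSpread
import Summits.ResolutionOfSingularities.ResolutionOfSingularities.Theorems.RadicialJungCleanModelsDeficiencyFiniteOver
import HarnessLib

/-!
# Route `RadicialJung`, crux `CleanModels` (stmt-ResolutionOfSingularities-15917), line `Sketch` rev 35, stub 6 `stub_cleanProp44` (X44c),
# work plan O8 / L7b-global, item (G1) WITH FINITENESS at ring level: clean-regular at the generic point of the curve ⟹ off one divisor
# and a FINITE set of primes, every point of the curve is clean-permissible

Memo `Cruxes/CleanModels/Lines/Sketch-memo-hand2-g9-stubs-5-7.md` §3b.  ✓ `exists_not_mem_forall_cleanPermissibleAt_or_deficient_of_cleanRegAt_generic`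
(p816977) left, for the clean type (2) at the generic point `𝔭` of the curve, the DEFICIENT primes `𝔮 ⊇ 𝔭` as possible exceptions.  With the
deficiency-finiteness theorem ✓ `finite_setOf_deficient_over` (`…DeficiencyFiniteOver.lean`, from `…DeficiencyFinite.lean`: the radicial cover is
singular above a deficient prime, and J-2 makes the singular locus finite) the exceptions are FINITELY MANY whenever `A/𝔭` is a one-dimensional
J-2 domain (`A` quasi-excellent and the curve one-dimensional):
* `exists_rep_not_mem_forall_cleanPermissibleAt_or_deficient_of_generic_unit'` — ✓ p816913 re-exported together with the relation
  `v = s₁^p u` in `A_𝔭` between the cleared representative `v ∈ A` and the given unit `u` (so that `v` is not a `p`-th power mod `𝔭` when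
  `u` is residually not a `p`-th power);
* `exists_not_mem_finite_forall_cleanPermissibleAt_of_generic_unit` — type (2): off `V(g)` and a finite set, clean-permissible;
* `exists_not_mem_finite_forall_cleanPermissibleAt_of_cleanRegAt_generic` — all clean types (types (1)/(3) have no exceptions, ✓ p816750/p816835).

Honest framing: OURS (bookkeeping); the scheme reading and «`C₀ ∖ W` finite» remain for L7b-global; nothing here proves X44c or any case of `CleanModels`.
-/

noncomputable section

set_option linter.dupNamespace false -- mandated namespace of this single-conjunct summit

open IsLocalRing Literature.AlgebraicGeometry.Resolution

namespace Summit.ResolutionOfSingularities.ResolutionOfSingularities.Theorems.RadicialJung.CleanModels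

/-- ✓ `exists_rep_not_mem_forall_cleanPermissibleAt_or_deficient_of_generic_unit` (p816913), exporting moreover the relation `v = s₁^p · u` in
`B = A_𝔭` (`s₁ ∉ 𝔭`) between the cleared representative `v ∈ A` and the unit `u`.  Proof verbatim as there.
[cite: CossartPiltant2008, Prop. 4.4 (proof, p. 10)] [cite: Piltant2013, §2 Axiom 4] -/
theorem exists_rep_not_mem_forall_cleanPermissibleAt_or_deficient_of_generic_unit' {A K : Type} [CommRing A] [IsDomain A] [Field K]
    [Algebra A K] [IsFractionRing A K] (p : ℕ) [hp : Fact p.Prime] [CharP K p] (𝔭 : Ideal A) [h𝔭 : 𝔭.IsPrime]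
    (B : Type) [CommRing B] [IsLocalRing B] [Algebra A B] [IsLocalization.AtPrime B 𝔭] [Algebra B K] [IsScalarTower A B K]
    (G : K) (cc : Fin p → K) (hcc : ∃ j : Fin p, (j : ℕ) ≠ 0 ∧ cc j ≠ 0) (u : B) (hu : IsUnit u)
    (hX : (∑ j : Fin p, cc j ^ p * G ^ (j : ℕ)) = algebraMap B K u) :
    ∃ (g v s₁ : A) (cc' : Fin p → K), g ∉ 𝔭 ∧ s₁ ∉ 𝔭 ∧ algebraMap A B v = algebraMap A B s₁ ^ p * u ∧
      (∃ j : Fin p, (j : ℕ) ≠ 0 ∧ cc' j ≠ 0) ∧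
      (∑ j : Fin p, cc' j ^ p * G ^ (j : ℕ)) = algebraMap A K v ∧ ∀ (𝔮 : Ideal A) [𝔮.IsPrime], g ∉ 𝔮 →
      ∀ (R : Type) [CommRing R] [IsRegularLocalRing R] [Algebra A R] [IsLocalization.AtPrime R 𝔮] [Algebra R K] [IsScalarTower A R K]
        (q : Fin 2 → A), IsRsopPart (fun j => algebraMap A R (q j)) →
        Ideal.span (Set.range fun j => algebraMap A R (q j)) = Ideal.map (algebraMap A R) 𝔭 →
        IsUnit (algebraMap A R v) ∧
        (CleanPermissibleAt p (algebraMap R K) G (Ideal.map (algebraMap A R) 𝔭) ∨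
          ∃ c : R, algebraMap A R v - c ^ p ∈ Ideal.map (algebraMap A R) 𝔭 ⊔ maximalIdeal R ^ 2) := by
  classical
  have hmemP : ∀ x : A, algebraMap A B x ∈ maximalIdeal B ↔ x ∈ 𝔭 := fun x => IsLocalization.AtPrime.to_map_mem_maximal_iff B 𝔭 x
  have hunitP : ∀ x : A, IsUnit (algebraMap A B x) ↔ x ∉ 𝔭 := fun x => IsLocalization.AtPrime.isUnit_to_map_iff B 𝔭 x
  have hinjK : Function.Injective (algebraMap A K) := IsFractionRing.injective A K
  obtain ⟨⟨v₀, s⟩, hus⟩ := IsLocalization.surj 𝔭.primeCompl u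
  have hs : (s : A) ∉ 𝔭 := s.2
  have hv₀ : v₀ ∉ 𝔭 := by
    intro h
    have h1 : algebraMap A B v₀ ∈ maximalIdeal B := (hmemP v₀).mpr h
    rw [← hus] at h1
    exact (maximalIdeal.isMaximal B).ne_top (Ideal.eq_top_of_isUnit_mem _ h1 (hu.mul ((hunitP s).mpr hs)))
  set v : A := (s : A) ^ (p - 1) * v₀ with hvdef
  have hvφ : algebraMap A B v = algebraMap A B s ^ p * u := by
    have hp1 : p = (p - 1) + 1 := (Nat.sub_add_cancel hp.out.one_le).symm
    rw [hvdef, map_mul, map_pow, ← hus]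
    conv_rhs => rw [hp1, pow_succ]
    ring
  have hsK : algebraMap A K s ≠ 0 := fun h0 => hs (by rw [(injective_iff_map_eq_zero _).mp hinjK _ h0]; exact 𝔭.zero_mem)
  obtain ⟨hcc', hX'⟩ := rep_scale_mul_pow p G cc hcc (algebraMap A K s) _ hsK hX
  have hXv : (∑ j : Fin p, (fun j => cc j * algebraMap A K s) j ^ p * G ^ (j : ℕ)) = algebraMap A K v := by
    rw [hX', IsScalarTower.algebraMap_apply A B K (s : A), ← map_pow, ← map_mul, ← hvφ, ← IsScalarTower.algebraMap_apply]
  refine ⟨(s : A) * v₀, v, s, _, fun h => (h𝔭.mem_or_mem h).elim hs hv₀, hs, hvφ, hcc', hXv, ?_⟩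
  intro 𝔮 _ hg R _ _ _ _ _ _ q hqrsop hqspan
  have hs𝔮 : (s : A) ∉ 𝔮 := fun h => hg (Ideal.mul_mem_right _ _ h)
  have hv₀𝔮 : v₀ ∉ 𝔮 := fun h => hg (Ideal.mul_mem_left _ _ h)
  set ψ := algebraMap A R with hψ
  have hunitQ : ∀ y : A, y ∉ 𝔮 → IsUnit (ψ y) := fun y hy => (IsLocalization.AtPrime.isUnit_to_map_iff R 𝔮 y).mpr hy
  have hvunit : IsUnit (ψ v) := by rw [hvdef, map_mul, map_pow]; exact ((hunitQ _ hs𝔮).pow _).mul (hunitQ _ hv₀𝔮)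
  refine ⟨hvunit, ?_⟩
  haveI hJreg : IsRegularLocalRing (R ⧸ (Ideal.map ψ 𝔭)) := by rw [← hqspan]; exact hqrsop.isRegularLocalRing_quotient
  have hJm : (Ideal.map ψ 𝔭) ≤ maximalIdeal R := by rw [← hqspan]; exact hqrsop.span_range_le_maximalIdeal
  have hXR : (∑ j : Fin p, (fun j => cc j * algebraMap A K s) j ^ p * G ^ (j : ℕ)) = algebraMap R K (ψ v) := by
    rw [hXv, IsScalarTower.algebraMap_apply A R K]
  by_cases hdef : ∃ c : R, ψ v - c ^ p ∈ (Ideal.map ψ 𝔭) ⊔ maximalIdeal R ^ 2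
  · exact Or.inr hdef
  left
  push Not at hdef
  by_cases hres : ∀ c : R, ψ v - c ^ p ∉ maximalIdeal R
  · exact cleanPermissibleAt_of_unit p (algebraMap R K) G (Ideal.map ψ 𝔭) _ hcc' (ψ v) hvunit hXR hres
  push Not at hres
  obtain ⟨c, hc⟩ := hres
  -- `w := ψ v − c^p` is a transversal parameter of contact one
  set w : R := ψ v - c ^ p with hwdef
  have hw2 : w ∉ (Ideal.map ψ 𝔭) ⊔ maximalIdeal R ^ 2 := hdef c
  obtain ⟨cc'', hcc'', hX''⟩ := rep_shift_sub_pow p (algebraMap R K) G _ hcc' (ψ v) c hXR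
  -- in `R/(Ideal.map ψ 𝔭)`, the class of `w` is a regular parameter
  haveI : IsLocalHom (Ideal.Quotient.mk (Ideal.map ψ 𝔭)) :=
    isLocalHom_of_le_jacobson_bot (Ideal.map ψ 𝔭) (by rw [IsLocalRing.jacobson_eq_maximalIdeal ⊥ bot_ne_top]; exact hJm)
  have hwbar : Ideal.Quotient.mk (Ideal.map ψ 𝔭) w ∈ maximalIdeal (R ⧸ (Ideal.map ψ 𝔭)) := by
    refine (mem_maximalIdeal _).mpr fun hunit => (mem_maximalIdeal _).mp hc ?_
    exact (isUnit_map_iff (Ideal.Quotient.mk (Ideal.map ψ 𝔭)) w).mp hunit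
  have hmle : maximalIdeal (R ⧸ (Ideal.map ψ 𝔭)) ≤ (maximalIdeal R).map (Ideal.Quotient.mk (Ideal.map ψ 𝔭)) := by
    intro z hz
    obtain ⟨y, rfl⟩ := Ideal.Quotient.mk_surjective z
    have hy : y ∈ maximalIdeal R := (mem_maximalIdeal _).mpr fun hyu => (mem_maximalIdeal _).mp hz (hyu.map _)
    exact Ideal.mem_map_of_mem _ hy
  have hwbar2 : Ideal.Quotient.mk (Ideal.map ψ 𝔭) w ∉ maximalIdeal (R ⧸ (Ideal.map ψ 𝔭)) ^ 2 := by
    intro h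
    have h1 : Ideal.Quotient.mk (Ideal.map ψ 𝔭) w ∈ ((maximalIdeal R) ^ 2).map (Ideal.Quotient.mk (Ideal.map ψ 𝔭)) := by
      rw [Ideal.map_pow]; exact Ideal.pow_right_mono hmle 2 h
    rw [Ideal.mem_map_iff_of_surjective _ Ideal.Quotient.mk_surjective] at h1
    obtain ⟨y, hy, hyw⟩ := h1
    apply hw2
    have : w = y + (w - y) := by ring
    rw [this]
    refine Ideal.add_mem _ (Ideal.mem_sup_right hy) (Ideal.mem_sup_left ?_)
    rw [← Ideal.Quotient.eq, hyw]
  have hbrsop : IsRsopPart (Ideal.Quotient.mk (Ideal.map ψ 𝔭) ∘ ![w]) := by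
    have : (Ideal.Quotient.mk (Ideal.map ψ 𝔭) ∘ ![w]) = ![Ideal.Quotient.mk (Ideal.map ψ 𝔭) w] := by ext i; fin_cases i; rfl
    rw [this]
    exact isRsopPart_singleton_of_not_mem_sq hwbar hwbar2
  have harsop : IsRsopPart (Fin.elim0 : Fin 0 → R) := by
    refine ⟨inferInstance, (maximalIdeal R).spanFinrank, Classical.choose (exists_regularSystemOfParameters (R := R)), ?_, ?_⟩
    · rw [zero_add]; exact (IsRegularLocalRing.spanFinrank_maximalIdeal (R := R)).symm
    · rw [Set.range_eq_empty, Set.empty_union]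
      exact Classical.choose_spec (exists_regularSystemOfParameters (R := R))
  have hX3 : (∑ j : Fin p, cc'' j ^ p * G ^ (j : ℕ)) =
      algebraMap R K (1 * (∏ k : Fin 0, (Fin.elim0 k : R) ^ (Fin.elim0 k : ℕ)) * ∏ k : Fin 1, (![w] : Fin 1 → R) k ^ (![1] : Fin 1 → ℕ) k) := by
    rw [hX'']; simp [hwdef]
  exact cleanPermissibleAt_of_split p (algebraMap R K) G (Ideal.map ψ 𝔭) cc'' hcc'' Fin.elim0 ![w] harsop (fun k => Fin.elim0 k)
    (fun k => by fin_cases k; exact hc) hbrsop Fin.elim0 ![1] (Or.inr ⟨0, by simpa using hp.out.one_lt.ne'⟩) 1 isUnit_one hX3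

/-- **Type (2), with finiteness.**  `A` a domain, `𝔭` a prime with `A/𝔭` a one-dimensional J-2 domain, `B = A_𝔭`, `K = Frac A` of
characteristic `p`; if the line of `G` has at `B` a unit representative `u` residually NOT a `p`-th power (clean type (2)), then there are
`g ∉ 𝔭` and a FINITE set `F` of primes such that at every prime `𝔮 ∉ F`, `g ∉ 𝔮`, with `A_𝔮` regular and `(q₀, q₁)` a regular pair
generating `𝔭A_𝔮`, the line is clean-permissible for `𝔭A_𝔮`. [cite: CossartPiltant2008, Prop. 4.4 (proof, p. 10)] [cite: Piltant2013, §2 Axiom 4] -/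
theorem exists_not_mem_finite_forall_cleanPermissibleAt_of_generic_unit {A K : Type} [CommRing A] [IsDomain A] [Field K]
    [Algebra A K] [IsFractionRing A K] (p : ℕ) [hp : Fact p.Prime] [CharP K p] (𝔭 : Ideal A) [h𝔭 : 𝔭.IsPrime]
    (hJ : IsJ2Ring (A ⧸ 𝔭)) [Ring.DimensionLEOne (A ⧸ 𝔭)]
    (B : Type) [CommRing B] [IsLocalRing B] [Algebra A B] [IsLocalization.AtPrime B 𝔭] [Algebra B K] [IsScalarTower A B K]
    (G : K) (cc : Fin p → K) (hcc : ∃ j : Fin p, (j : ℕ) ≠ 0 ∧ cc j ≠ 0) (u : B) (hu : IsUnit u)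
    (hX : (∑ j : Fin p, cc j ^ p * G ^ (j : ℕ)) = algebraMap B K u) (hup : ∀ c : B, u - c ^ p ∉ maximalIdeal B) :
    ∃ (g : A) (F : Set (Ideal A)), g ∉ 𝔭 ∧ F.Finite ∧ ∀ (𝔮 : Ideal A) [𝔮.IsPrime], g ∉ 𝔮 → 𝔮 ∉ F →
      ∀ (R : Type) [CommRing R] [IsRegularLocalRing R] [Algebra A R] [IsLocalization.AtPrime R 𝔮] [Algebra R K] [IsScalarTower A R K]
        (q : Fin 2 → A), IsRsopPart (fun j => algebraMap A R (q j)) →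
        Ideal.span (Set.range fun j => algebraMap A R (q j)) = Ideal.map (algebraMap A R) 𝔭 →
        CleanPermissibleAt p (algebraMap R K) G (Ideal.map (algebraMap A R) 𝔭) := by
  classical
  haveI : CharP A p := ⟨fun n => by
    rw [← map_eq_zero_iff (algebraMap A K) (IsFractionRing.injective A K), map_natCast]
    exact CharP.cast_eq_zero_iff K p n⟩
  obtain ⟨g, v, s₁, cc', hg, hs₁, hvu, -, -, hall⟩ :=
    exists_rep_not_mem_forall_cleanPermissibleAt_or_deficient_of_generic_unit' p 𝔭 B G cc hcc u hu hX
  -- `v` is not a `p`-th power modulo `𝔭`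
  have hmemP : ∀ x : A, algebraMap A B x ∈ maximalIdeal B ↔ x ∈ 𝔭 := fun x => IsLocalization.AtPrime.to_map_mem_maximal_iff B 𝔭 x
  have hunitP : ∀ x : A, IsUnit (algebraMap A B x) ↔ x ∉ 𝔭 := fun x => IsLocalization.AtPrime.isUnit_to_map_iff B 𝔭 x
  have hv : ∀ c s : A, s ∉ 𝔭 → s ^ p * v - c ^ p ∉ 𝔭 := by
    intro c s hs hmem
    have hw : IsUnit (algebraMap A B (s * s₁)) := (hunitP _).mpr fun h => (h𝔭.mem_or_mem h).elim hs hs₁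
    obtain ⟨w, hw'⟩ := hw
    have h1 : algebraMap A B (s ^ p * v - c ^ p) = (w : B) ^ p * u - algebraMap A B c ^ p := by
      rw [map_sub, map_mul, map_pow, map_pow, hvu, ← mul_assoc, ← mul_pow, ← map_mul, hw']
    apply hup (algebraMap A B c * ↑(w⁻¹))
    have h2 : u - (algebraMap A B c * ↑(w⁻¹)) ^ p = ↑(w⁻¹) ^ p * ((w : B) ^ p * u - algebraMap A B c ^ p) := by
      have hw1 : (↑(w⁻¹) : B) * (w : B) = 1 := Units.inv_mul w
      calc u - (algebraMap A B c * ↑(w⁻¹)) ^ p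
          = ((↑(w⁻¹) : B) * (w : B)) ^ p * u - (algebraMap A B c) ^ p * (↑(w⁻¹) : B) ^ p := by
            rw [hw1, one_pow, one_mul, mul_pow]
        _ = _ := by ring
    rw [h2, ← h1]
    exact Ideal.mul_mem_left _ _ ((hmemP _).mpr hmem)
  refine ⟨g, {𝔮 : Ideal A | 𝔮.IsPrime ∧ 𝔭 ≤ 𝔮 ∧ ∃ s e : A, s ∉ 𝔮 ∧ s ^ p * v - e ^ p ∈ 𝔭 ⊔ 𝔮 ^ 2}, hg,
    finite_setOf_deficient_over p 𝔭 hJ v hv, ?_⟩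
  intro 𝔮 _ hg𝔮 hF R _ _ _ _ _ _ q hqrsop hqspan
  obtain ⟨-, hdich⟩ := hall 𝔮 hg𝔮 R q hqrsop hqspan
  rcases hdich with hperm | ⟨c, hc⟩
  · exact hperm
  · exfalso
    apply hF
    have h𝔭𝔮 : 𝔭 ≤ 𝔮 := by
      intro x hx
      have h1 : algebraMap A R x ∈ maximalIdeal R := by
        have h0 := hqrsop.span_range_le_maximalIdeal
        rw [hqspan] at h0
        exact h0 (Ideal.mem_map_of_mem _ hx)
      exact (IsLocalization.AtPrime.to_map_mem_maximal_iff R 𝔮 x).mp h1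
    obtain ⟨s, e, hs, hse⟩ := exists_deficient_of_localization p hp.out.ne_zero 𝔭 𝔮 R v c hc
    exact ⟨inferInstance, h𝔭𝔮, s, e, hs, hse⟩

/-- **(G1) at ring level, with finiteness.**  As ✓ `exists_not_mem_forall_cleanPermissibleAt_or_deficient_of_cleanRegAt_generic` (p816977), but
with `A/𝔭` a one-dimensional J-2 domain: clean-regularity of the line at `B = A_𝔭` (`dim B = 2`, `(q₀,q₁)` generating `𝔪_B`) yields `g ∉ 𝔭` and a
FINITE set `F` of primes off which (and off `V(g)`) the line is clean-permissible for `𝔭A_𝔮` at every prime `𝔮` with `A_𝔮` regular and `(q₀,q₁)` a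
regular pair generating `𝔭A_𝔮`. [cite: CossartPiltant2008, Prop. 4.4 (proof, p. 10)] [cite: Piltant2013, §2 Axiom 4] [cite: Matsumura1987, Thm. 14.2] -/
theorem exists_not_mem_finite_forall_cleanPermissibleAt_of_cleanRegAt_generic {A K : Type} [CommRing A] [IsDomain A] [Field K]
    [Algebra A K] [IsFractionRing A K] (p : ℕ) [hp : Fact p.Prime] [CharP K p] (𝔭 : Ideal A) [h𝔭 : 𝔭.IsPrime]
    (hJ : IsJ2Ring (A ⧸ 𝔭)) [Ring.DimensionLEOne (A ⧸ 𝔭)]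
    (B : Type) [CommRing B] [IsLocalRing B] [Algebra A B] [IsLocalization.AtPrime B 𝔭] [Algebra B K] [IsScalarTower A B K]
    (q : Fin 2 → A) (hq : Ideal.map (algebraMap A B) (Ideal.span (Set.range q)) = maximalIdeal B) (hdimB : ringKrullDim B = 2)
    (G : K) (hG : CleanRegAt p (algebraMap B K) G) :
    ∃ (g : A) (F : Set (Ideal A)), g ∉ 𝔭 ∧ F.Finite ∧ ∀ (𝔮 : Ideal A) [𝔮.IsPrime], g ∉ 𝔮 → 𝔮 ∉ F →
      ∀ (R : Type) [CommRing R] [IsRegularLocalRing R] [Algebra A R] [IsLocalization.AtPrime R 𝔮] [Algebra R K] [IsScalarTower A R K],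
        IsRsopPart (fun j => algebraMap A R (q j)) → Ideal.span (Set.range fun j => algebraMap A R (q j)) = Ideal.map (algebraMap A R) 𝔭 →
        CleanPermissibleAt p (algebraMap R K) G (Ideal.map (algebraMap A R) 𝔭) := by
  classical
  obtain ⟨hregB, cc, hcc, hform⟩ := hG
  rcases hform with ⟨d, m, hmd, t, a, u, hu, hspan, hdim, hm, ha, hGX⟩ | ⟨u, hu, hGX, hup⟩ | ⟨s', c', hGX, hsc, hsc2⟩
  · -- type (1): no exceptions
    have hd2 : d = 2 := by
      rw [hdim] at hdimB; exact_mod_cast hdimB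
    subst hd2
    have hdB : (maximalIdeal B).spanFinrank = 2 := by
      have h := IsRegularLocalRing.spanFinrank_maximalIdeal (R := B)
      rw [hdim] at h
      exact_mod_cast h
    have htrsop : IsRsopPart (t ∘ Fin.castLE hmd) := isRsopPart_comp_of_rsop hdB t hspan (Fin.castLE hmd) (Fin.castLE_injective hmd)
    obtain rfl | rfl : m = 1 ∨ m = 2 := by omega
    · have hX1 : (∑ j : Fin p, cc j ^ p * G ^ (j : ℕ)) = algebraMap B K (u * t (Fin.castLE hmd 0) ^ a 0) := by
        rw [hGX, Fin.prod_univ_one]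
      obtain ⟨g, hg, hall⟩ := exists_not_mem_forall_cleanPermissibleAt_of_generic_simple p 𝔭 B q hq G cc hcc (t (Fin.castLE hmd 0))
        (by rw [← hspan]; exact Ideal.subset_span ⟨_, rfl⟩) (htrsop.not_mem_sq 0) (a 0) (ha 0) u hu hX1
      exact ⟨g, ∅, hg, Set.finite_empty, fun 𝔮 _ hg𝔮 _ R _ _ _ _ _ _ hqr hqs => (hall 𝔮 hg𝔮 R hqr hqs).elim fun _ h => h.2⟩
    · have hX2 : (∑ j : Fin p, cc j ^ p * G ^ (j : ℕ)) = algebraMap B K (u * ∏ i, t i ^ a i) := by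
        rw [hGX]; exact congrArg _ (congrArg (u * ·) (Finset.prod_congr rfl fun i _ => by rw [show Fin.castLE hmd i = i from Fin.ext rfl]))
      obtain ⟨g, hg, hall⟩ := exists_not_mem_forall_cleanPermissibleAt_of_generic_pair p 𝔭 B q hq G cc hcc t hspan a ha u hu hX2
      exact ⟨g, ∅, hg, Set.finite_empty, fun 𝔮 _ hg𝔮 _ R _ _ _ _ _ _ hqr hqs => (hall 𝔮 hg𝔮 R hqr hqs).elim fun _ h => h.2⟩
  · -- type (2): finitely many deficient exceptions
    obtain ⟨g, F, hg, hF, hall⟩ :=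
      exists_not_mem_finite_forall_cleanPermissibleAt_of_generic_unit p 𝔭 hJ B G cc hcc u hu hGX hup
    exact ⟨g, F, hg, hF, fun 𝔮 _ hg𝔮 hF𝔮 R _ _ _ _ _ _ hqr hqs => hall 𝔮 hg𝔮 hF𝔮 R q hqr hqs⟩
  · -- type (3): no exceptions
    obtain ⟨cc₁, hcc₁, hX₁⟩ := rep_shift_sub_pow p (algebraMap B K) G cc hcc s' c' hGX
    have hX₁' : (∑ j : Fin p, cc₁ j ^ p * G ^ (j : ℕ)) = algebraMap B K (1 * (s' - c' ^ p) ^ 1) := by rw [hX₁, one_mul, pow_one]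
    obtain ⟨g, hg, hall⟩ := exists_not_mem_forall_cleanPermissibleAt_of_generic_simple p 𝔭 B q hq G cc₁ hcc₁ (s' - c' ^ p) hsc hsc2 1
      (fun h1 => hp.out.ne_one (Nat.dvd_one.mp h1)) 1 isUnit_one hX₁'
    exact ⟨g, ∅, hg, Set.finite_empty, fun 𝔮 _ hg𝔮 _ R _ _ _ _ _ _ hqr hqs => (hall 𝔮 hg𝔮 R hqr hqs).elim fun _ h => h.2⟩

end Summit.ResolutionOfSingularities.ResolutionOfSingularities.Theorems.RadicialJung.CleanModels

end
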